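import Summits.BirchSwinnertonDyer.BirchSwinnertonDyer.Theorems.PrintCf2SplitBadTwoFramePinning
import Literature.NumberTheory.EllipticCurves.QuadraticTwistLocalDataAtTwoHoldsProofs
import HarnessLib

set_option linter.dupNamespace false
set_option autoImplicit false

/-!
# Crux `PrintCf2.SplitBadTwoRankOneOfFacts` (stmt-BirchSwinnertonDyer-20368), road α — FRAME PINNING, II:
# the 20368 frame at `2` — `W` additive at `2`, `ψ` RAMIFIED at `v` and `v̄`, `c • v = v̄`, `c • S = S`

Width seat `bsd-line-cf2-p1-w6` (brick B8 «pinning lemma», 2026-08-28); sequel of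
`PrintCf2SplitBadTwoFramePinning.lean` (uniqueness of the pinned `(1,0)` character; ramification of a
pinned character above an additive prime unramified in `K`). Helper `--supports`
stmt-BirchSwinnertonDyer-20368; THEOREMS ONLY (no `def`, no named fact, no `sorry`).

In the binder currency of the registered stubs `stub_rubinValueFormula_two` / `stub_ellipticUnitDescent_two`
(skeleton v8 `18fa9a3c83355c23`): `W/ℚ` with `C • W = cm7^{(d)}`, `d ≢ 1 (mod 4)` squarefree; `K`
imaginary quadratic with two places `v ≠ v̄` above `2`; `c ≠ 1`; `ψ` of infinity type `(1,0)` with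
`heckeLFunction ψ s = W.LSeries s` on `re s > 3/2`; `S` the exact tame set (`w ∈ S ↔ ψ` ramified at `w`,
`w ∉ {v, v̄}`).

* `not_hasGoodReductionAtPrime_two_of_smul_eq_cm7Twist`, `hasAdditiveReductionAt_two_of_smul_eq_cm7Twist` —
  `W` is ADDITIVE at `2` (Barrios et al. 2025 rows `I₀` for the good curve `cm7 = 49a1` at `2`: the twist by
  `d ≡ 2, 3 (mod 4)` has Kodaira type `I₈*`/`II` resp. `I₄*`/`II*`, never `I₀`; a CM curve is never
  multiplicative; local trichotomy) — the same argument as cell bsd-goldfeld's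
  `not_hasGoodReductionAtPrime_two_of_smul_eq_quadraticTwist`, restated to keep this file off that route's
  import cone;
* `not_two_dvd_discr_of_ne` — two distinct places above `2` force `2 ∤ d_K`;
* `not_isUnramifiedAt_two_of_frame` — **`ψ` is ramified at `v` AND at `v̄`** (file I §2 at `p = 2`), for
  EVERY pinned `ψ` (no infinity type, no Deuring) — LEAD-VERDICT-cf2p1-g9 §2's "`λ_W` is ramified at `v`"
  as a kernel fact;
* `smul_eq_of_frame` (`c • v = v̄`), `image_smul_frameSet_eq` (`c • S = S` for a conj-equivariant `ψ`);
* `framePinning_two` — the package: equivariance (bsd-cm's `DeuringShape.isHeckeConjEquivariant_of_pinned`),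
  ramification at `v`, `v̄`, `c • v = v̄`, `c • S = S`, UNIQUENESS of `ψ` among `(1,0)` characters pinned to
  `W` (file I §1), `2 ∤ d_K`.

HONEST FRAMING: kernel theorems about Hecke characters and reduction types; nothing is claimed about BSD;
no stub of the skeleton is closed by this file; 20368 stays OPEN. beyond-print theorem: no.

References: [BarriosEtAl2025] Thm. 5.1 rows `I₀`; [SilvermanAEC2009] VII.5 Prop. 5.1, App. C §16;
[SilvermanATAEC1994] II Thm. 9.2, 10.5, Thm. II.6.4; [NeukirchANT1999] I §8–§9, VII §8 (8.1);
[deShalit1987] II.6.1.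
-/

noncomputable section

open scoped Classical
open Filter NumberField IsDedekindDomain WeierstrassCurve
  Literature.NumberTheory.GaloisRepresentations
  Literature.NumberTheory.LFunctions
  Literature.NumberTheory.EllipticCurves
  Literature.NumberTheory.EllipticCurves.ModularForms
  Summit.BirchSwinnertonDyer.BirchSwinnertonDyer.Theorems.RamifiedSevenEllipticUnits

namespace Summit.BirchSwinnertonDyer.BirchSwinnertonDyer.Theorems.PrintCf2.FramePinning

variable {K : Type} [Field K] [NumberField K]

/-! ## §3 The 20368 frame: `W` additive at `2`; `ψ` ramified at `v`, `v̄`; `c • v = v̄`; `c • S = S` -/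

/-- **Twists `W ≅ cm7^{(d)}` with `d ≡ 2, 3 (mod 4)` are NOT good at `2`** (any model):
Barrios–Roy–Sahajpal–Tallana–Tobin–Wiersema 2025, Thm. 5.1, rows `I₀` (tree theorem
`BarriosEtAl2025_quadraticTwist_two_of_goodReduction_holds`): over `ℚ₂` the twist of the good curve
`cm7 = 49a1` has Kodaira type `I₄*`/`II*` (`d ≡ 3`) or `I₈*`/`II` (`d ≡ 2 (mod 4)`), never `I₀`; the
Kodaira symbol is a `ℚ₂`-isomorphism invariant (`kodairaSymbol_smul_holds`). (Same argument as cell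
bsd-goldfeld's `not_hasGoodReductionAtPrime_two_of_smul_eq_quadraticTwist`, restated here to keep this
file free of that file's route imports.)
[cite: BarriosEtAl2025, Thm. 5.1 with the rows R = I₀ of the §5 tables (arXiv:2501.03209 pp. 15–16)]
[cite: SilvermanATAEC1994, IV.9.4 (Tate's algorithm, Step 1)] -/
theorem not_hasGoodReductionAtPrime_two_of_smul_eq_cm7Twist (W : WeierstrassCurve ℚ) [W.IsElliptic]
    {d : ℤ} (hd : d % 4 = 2 ∨ d % 4 = 3) {C : VariableChange ℚ}
    (hC : C • W = cm7.quadraticTwist (d : ℚ)) : ¬ W.HasGoodReductionAtPrime 2 := by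
  intro hgood
  haveI := TwistGoodTwo.perfectField_residueField_padicInt
  haveI := cm7_isGloballyMinimal
  have hB := BarriosEtAl2025_quadraticTwist_two_of_goodReduction_holds (cm7.baseChange ℚ_[2])
    cm7_hasGoodReductionAtPrime_two d
  -- `W ⊗ ℚ₂ ≅ (cm7 ⊗ ℚ₂)^{(d)}`
  have hbc : (C.map (algebraMap ℚ ℚ_[2])) • W.baseChange ℚ_[2] =
      (cm7.baseChange ℚ_[2]).quadraticTwist (d : ℚ_[2]) := by
    simp only [WeierstrassCurve.baseChange]
    rw [map_variableChange, hC, map_quadraticTwist, map_intCast]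
  -- good reduction of `W` at `2` would mean Kodaira symbol `I₀`
  have hI0 : (W.baseChange ℚ_[2]).kodairaSymbol ℤ_[2] = .I 0 := by
    haveI : ((W.baseChange ℚ_[2]).minimal ℤ_[2]).HasGoodReduction ℤ_[2] := hgood
    unfold WeierstrassCurve.kodairaSymbol
    exact TwistGoodTwo.kodairaSymbolOfMinimal_eq_I_zero_of_isUnit_Δ _
      (TwistGoodTwo.isUnit_Δ_integralModel_of_hasGoodReduction _)
  have hK : ((cm7.baseChange ℚ_[2]).quadraticTwist (d : ℚ_[2])).kodairaSymbol ℤ_[2] = .I 0 := by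
    rw [← hbc, kodairaSymbol_smul_holds ℤ_[2] (W.baseChange ℚ_[2]), hI0]
  rcases hd with hd2 | hd3
  · obtain ⟨h, -⟩ := hB.2.2 (by unfold Int.ModEq; omega)
    rw [hK] at h
    rcases h with h | h <;> exact absurd h (by decide)
  · obtain ⟨h, -⟩ := hB.2.1 (by unfold Int.ModEq; omega)
    rw [hK] at h
    rcases h with h | h <;> exact absurd h (by decide)

/-- **A member `W ≅ cm7^{(d)}` of the split-bad class (`d ≢ 1 (mod 4)` squarefree) is ADDITIVE at `2`**:
not good (`not_hasGoodReductionAtPrime_two_of_smul_eq_cm7Twist`; squarefree `d ≢ 1` means `d ≡ 2, 3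
(mod 4)`), not multiplicative (CM, `j = −3375`: `not_hasMultiplicativeReductionAtPrime_of_hasCM`), and the
local trichotomy at the place `v₂` of `ℚ` over `2`. [cite: SilvermanAEC2009, VII.5 Prop. 5.1]
[cite: SilvermanATAEC1994, Thm. II.6.4 (CM curves have potentially good reduction)] -/
theorem hasAdditiveReductionAt_two_of_smul_eq_cm7Twist (W : WeierstrassCurve ℚ) [W.IsElliptic]
    {d : ℤ} (hsq : Squarefree d) (hd4 : d % 4 ≠ 1) {C : VariableChange ℚ}
    (hC : C • W = cm7.quadraticTwist (d : ℚ)) (v₂ : HeightOneSpectrum (𝓞 ℚ))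
    (hv₂ : (Rat.HeightOneSpectrum.primesEquiv v₂ : ℕ) = 2) : W.HasAdditiveReductionAt v₂ := by
  have hd0 : d ≠ 0 := hsq.ne_zero
  have hd40 : d % 4 ≠ 0 := fun h ↦ by
    have h4 : (4 : ℤ) ∣ d := by omega
    have hu := hsq 2 (by simpa [show (2 : ℤ) * 2 = 4 by norm_num] using h4)
    rw [Int.isUnit_iff] at hu
    omega
  have hd : d % 4 = 2 ∨ d % 4 = 3 := by omega
  have hdQ : (d : ℚ) ≠ 0 := by exact_mod_cast hd0
  haveI := cm7.isElliptic_quadraticTwist hdQ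
  have hj : W.j = -3375 := by
    have key : ∀ (V : WeierstrassCurve ℚ) [V.IsElliptic], V = cm7.quadraticTwist (d : ℚ) → V.j = -3375 := by
      rintro V _ rfl
      rw [j_quadraticTwist cm7 hdQ, j_cm7]
    rw [← variableChange_j W C]
    exact key (C • W) hC
  have hng := not_hasGoodReductionAtPrime_two_of_smul_eq_cm7Twist W hd hC
  have hnm : ¬ W.HasMultiplicativeReductionAtPrime 2 :=
    not_hasMultiplicativeReductionAtPrime_of_hasCM W (hasCM_of_j_eq_neg3375 W hj) 2
  rcases hasGoodReductionAt_or_hasMultiplicativeReductionAt_or_hasAdditiveReductionAt v₂ W with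
    hg | hm | ha
  · exact absurd ((hasGoodReductionAtPrime_primesEquiv_iff_holds W v₂ 2 hv₂).mpr hg) hng
  · exact absurd ((hasMultiplicativeReductionAtPrime_primesEquiv_iff_holds W v₂ 2 hv₂).mpr hm) hnm
  · exact ha

/-- **Two distinct places above `2` force `2 ∤ d_K`** (`K` quadratic): at a prime dividing the
discriminant there is exactly one prime of `𝓞_K` above it (bsd-cm's `LemmaXi.eq_asIdeal_of_dvd_discr`).
[cite: NeukirchANT1999, Ch. I §8 Prop. (8.2) and §9 Prop. (9.6)] -/
theorem not_two_dvd_discr_of_ne (h2 : Module.finrank ℚ K = 2) {v vbar : HeightOneSpectrum (𝓞 K)}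
    (hv : ((2 : ℕ) : 𝓞 K) ∈ v.asIdeal) (hvbar : ((2 : ℕ) : 𝓞 K) ∈ vbar.asIdeal) (hne : vbar ≠ v) :
    ¬ (2 : ℤ) ∣ NumberField.discr K := by
  intro hdvd
  haveI := vbar.isPrime
  exact hne (HeightOneSpectrum.ext
    (LemmaXi.eq_asIdeal_of_dvd_discr (p := 2) h2 (by exact_mod_cast hdvd) v hv hvbar))

/-- **In the 20368 frame the pinned character is RAMIFIED at BOTH places above `2`.** For `W/ℚ`
elliptic with `C • W = cm7^{(d)}`, `d ≢ 1 (mod 4)` squarefree (so `W` is additive at `2`), `K` imaginary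
quadratic with two distinct places `v ≠ v̄` above `2` (so `2 ∤ d_K`), and ANY Hecke character `ψ` of `K`
with `heckeLFunction ψ s = W.LSeries s` on `re s > 3/2`: `ψ` is ramified at `v` and at `v̄`. No infinity
type, no Deuring. (LEAD-VERDICT-cf2p1-g9 §2 "`λ_W` is ramified at `v`", now a kernel fact.)
[cite: SilvermanAEC2009, App. C §16] [cite: NeukirchANT1999, Ch. VII §8 (8.1)] -/
theorem not_isUnramifiedAt_two_of_frame (hK : IsImaginaryQuadratic K)
    {d : ℤ} (hsq : Squarefree d) (hd4 : d % 4 ≠ 1)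
    (W : WeierstrassCurve ℚ) [W.IsElliptic] {C : VariableChange ℚ}
    (hC : C • W = cm7.quadraticTwist (d : ℚ))
    {v vbar : HeightOneSpectrum (𝓞 K)} (hv : ((2 : ℕ) : 𝓞 K) ∈ v.asIdeal)
    (hvbar : ((2 : ℕ) : 𝓞 K) ∈ vbar.asIdeal) (hne : vbar ≠ v)
    {ψ : HeckeCharacter K} (hpin : ∀ s : ℂ, 3 / 2 < s.re → heckeLFunction ψ s = W.LSeries s) :
    ¬ ψ.IsUnramifiedAt v ∧ ¬ ψ.IsUnramifiedAt vbar := by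
  set v₂ : HeightOneSpectrum (𝓞 ℚ) := Rat.HeightOneSpectrum.primesEquiv.symm ⟨2, Nat.prime_two⟩
    with hv₂def
  have hv₂ : (Rat.HeightOneSpectrum.primesEquiv v₂ : ℕ) = 2 := by
    rw [hv₂def, Equiv.apply_symm_apply]
  have hadd := hasAdditiveReductionAt_two_of_smul_eq_cm7Twist W hsq hd4 hC v₂ hv₂
  have hnd := not_two_dvd_discr_of_ne hK.1 hv hvbar hne
  exact ⟨not_isUnramifiedAt_of_pinned_of_hasAdditiveReductionAt hK.1 W (3 / 2) hpin hnd hv₂ hadd v hv,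
    not_isUnramifiedAt_of_pinned_of_hasAdditiveReductionAt hK.1 W (3 / 2) hpin hnd hv₂ hadd vbar hvbar⟩

/-- **`c • v = v̄` for the two places of the frame above `2`** (`Gal(K/ℚ) = {1, c}` acts transitively on
the primes above the split prime `2`). [cite: NeukirchANT1999, Ch. I §9 Prop. (9.1)] [cite: Marcus2018, Ch. 4 (before Thm. 29)] -/
theorem smul_eq_of_frame (h2 : Module.finrank ℚ K = 2) (c : K ≃ₐ[ℚ] K) (hc : c ≠ 1)
    {v vbar : HeightOneSpectrum (𝓞 K)} (hv : ((2 : ℕ) : 𝓞 K) ∈ v.asIdeal)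
    (hvbar : ((2 : ℕ) : 𝓞 K) ∈ vbar.asIdeal) (hne : vbar ≠ v) : c • v = vbar := by
  have hnd := not_two_dvd_discr_of_ne h2 hv hvbar hne
  set u : HeightOneSpectrum (𝓞 ℚ) := v.under (𝓞 ℚ) with hu
  have hvu : v.asIdeal.under (𝓞 ℚ) = u.asIdeal := rfl
  have hgen : Rat.HeightOneSpectrum.natGenerator u = 2 :=
    natGenerator_under_eq_of_natCast_mem v Nat.prime_two hv
  have he : u.asIdeal.ramificationIdxIn (𝓞 K) = 1 :=
    ramificationIdxIn_eq_one_of_not_dvd_discr (K := K) u (by rw [hgen]; exact hnd)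
  have hvbaru : vbar.asIdeal.under (𝓞 ℚ) = u.asIdeal :=
    (asIdeal_under_eq_iff_natCast_mem u vbar).mpr (by rw [hgen]; exact hvbar)
  rcases exists_places_eq_pair_or_eq_singleton h2 u he with
    ⟨w₁, w₂, hne', hS, -, -⟩ | ⟨w₀, hS, -⟩
  · have hv' : v ∈ ({w₁, w₂} : Set (HeightOneSpectrum (𝓞 K))) := by rw [← hS]; exact hvu
    have hvbar' : vbar ∈ ({w₁, w₂} : Set (HeightOneSpectrum (𝓞 K))) := by rw [← hS]; exact hvbaru
    simp only [Set.mem_insert_iff, Set.mem_singleton_iff] at hv' hvbar'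
    rcases hv' with h₁ | h₁ <;> rcases hvbar' with h₂ | h₂
    · exact absurd (h₂.trans h₁.symm) hne
    · subst h₁; subst h₂
      exact Rigidity.smul_eq_of_places_eq_pair h2 c hc u hne' hS
    · subst h₁; subst h₂
      exact Rigidity.smul_eq_of_places_eq_pair h2 c hc u hne'.symm (by rw [hS, Set.pair_comm])
    · exact absurd (h₂.trans h₁.symm) hne
  · have hv' : v ∈ ({w₀} : Set (HeightOneSpectrum (𝓞 K))) := by rw [← hS]; exact hvu
    have hvbar' : vbar ∈ ({w₀} : Set (HeightOneSpectrum (𝓞 K))) := by rw [← hS]; exact hvbaru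
    simp only [Set.mem_singleton_iff] at hv' hvbar'
    exact absurd (hvbar'.trans hv'.symm) hne

/-- **The exact tame set of the frame is conjugation-stable: `c • S = S`.** In the frame, `S` is the set
of places `w ∉ {v, v̄}` at which `ψ` is ramified; `ψ` is conj-equivariant, so `ψ` is unramified at `c • w`
iff at `w`, and `c` swaps `v` and `v̄`. Hence `S.image (c • ·) = S` (the modulus at which de Shalit's
functional equation / reflection returns the frame). [cite: deShalit1987, II.6.1 ("𝔣_ε̌ = 𝔣̄_ε")]
[cite: SilvermanATAEC1994, Ch. II Thm. 10.5 (b)] -/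
theorem image_smul_frameSet_eq (h2 : Module.finrank ℚ K = 2) (c : K ≃ₐ[ℚ] K) (hc : c ≠ 1)
    {ψ : HeckeCharacter K} (heq : IsHeckeConjEquivariant c ψ)
    {v vbar : HeightOneSpectrum (𝓞 K)} (hv : ((2 : ℕ) : 𝓞 K) ∈ v.asIdeal)
    (hvbar : ((2 : ℕ) : 𝓞 K) ∈ vbar.asIdeal) (hne : vbar ≠ v)
    {S : Finset (HeightOneSpectrum (𝓞 K))}
    (hS : ∀ w : HeightOneSpectrum (𝓞 K), w ∈ S ↔ (¬ ψ.IsUnramifiedAt w ∧ w ≠ v ∧ w ≠ vbar)) :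
    S.image (fun w ↦ c • w) = S := by
  classical
  have hcc : c * c = 1 := by
    rcases Literature.NumberTheory.QuadraticFields.eq_one_or_eq_of_card_eq_two
      (Rigidity.card_algEquiv_eq_two h2) hc (c * c) with h | h
    · exact h
    · exact absurd (mul_left_cancel (h.trans (mul_one c).symm)) hc
  have hinv : ∀ w : HeightOneSpectrum (𝓞 K), c • (c • w) = w := fun w ↦ by
    rw [← mul_smul, hcc, one_smul]
  have hcv : c • v = vbar := smul_eq_of_frame h2 c hc hv hvbar hne
  have hcvbar : c • vbar = v := by rw [← hcv, hinv]
  have hunr : ∀ w : HeightOneSpectrum (𝓞 K), ψ.IsUnramifiedAt (c • w) ↔ ψ.IsUnramifiedAt w :=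
    fun w ↦ by rw [← HeckeCharacter.isUnramifiedAt_galConj_iff c ψ w, heq.isUnramifiedAt_galConj_iff' w]
  have h1 : ∀ w : HeightOneSpectrum (𝓞 K), c • w = v ↔ w = vbar := fun w ↦
    ⟨fun h ↦ by rw [← hinv w, h, hcv], fun h ↦ by rw [h, hcvbar]⟩
  have h2' : ∀ w : HeightOneSpectrum (𝓞 K), c • w = vbar ↔ w = v := fun w ↦
    ⟨fun h ↦ by rw [← hinv w, h, hcvbar], fun h ↦ by rw [h, hcv]⟩
  have hmem : ∀ w : HeightOneSpectrum (𝓞 K), c • w ∈ S ↔ w ∈ S := fun w ↦ by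
    rw [hS, hS, hunr, Ne, Ne, h1, h2']
    tauto
  ext w
  simp only [Finset.mem_image]
  constructor
  · rintro ⟨u, hu, rfl⟩
    exact (hmem u).mpr hu
  · intro hw
    exact ⟨c • w, (hmem (c • w)).mp (by rw [hinv]; exact hw), hinv w⟩

/-- **FRAME PINNING PACKAGE at `2` for road α** — in the binder currency of the registered stubs
`stub_rubinValueFormula_two` / `stub_ellipticUnitDescent_two` (skeleton v8 `18fa9a3c83355c23` of crux
stmt-BirchSwinnertonDyer-20368): for every member `W` (`C • W = cm7^{(d)}`, `d ≢ 1 (mod 4)` squarefree),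
every frame field `K` (imaginary quadratic, `2 = v v̄` split), `c ≠ 1`, and every `ψ` of infinity type
`(1, 0)` pinned to `W`:
(i) `ψ` is conj-equivariant (`ψ(c • x) = conj ψ(x)`; bsd-cm's `DeuringShape.isHeckeConjEquivariant_of_pinned`);
(ii) `ψ` is RAMIFIED at `v` and at `v̄`; (iii) `c • v = v̄`; (iv) the exact tame set `S` is `c`-stable;
(v) `ψ` is UNIQUE: every `(1,0)` character of `K` pinned to `W` equals `ψ`; (vi) `2 ∤ d_K`.
THEOREMS ONLY; does not close any stub; BSD is not claimed.
[cite: SilvermanATAEC1994, Ch. II Thm. 9.2, Thm. 10.5 (shape of Deuring's character; here derived for every frame)]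
[cite: NeukirchANT1999, Ch. VII §6 Prop. (6.13), §8 (8.1)] -/
theorem framePinning_two {d : ℤ} (hsq : Squarefree d) (hd4 : d % 4 ≠ 1)
    (W : WeierstrassCurve ℚ) [W.IsElliptic] (C : VariableChange ℚ)
    (hC : C • W = cm7.quadraticTwist (d : ℚ))
    (hK : IsImaginaryQuadratic K)
    (v vbar : HeightOneSpectrum (𝓞 K)) (hv : ((2 : ℕ) : 𝓞 K) ∈ v.asIdeal)
    (hvbar : ((2 : ℕ) : 𝓞 K) ∈ vbar.asIdeal) (hne : vbar ≠ v)
    (c : K ≃ₐ[ℚ] K) (hc : c ≠ 1)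
    (ψ : HeckeCharacter K) (hψ : ψ.HasInfinityType (fun _ ↦ 1) (fun _ ↦ 0))
    (hL : ∀ s : ℂ, 3 / 2 < s.re → heckeLFunction ψ s = W.LSeries s)
    (S : Finset (HeightOneSpectrum (𝓞 K)))
    (hS : ∀ w : HeightOneSpectrum (𝓞 K), w ∈ S ↔ (¬ ψ.IsUnramifiedAt w ∧ w ≠ v ∧ w ≠ vbar)) :
    IsHeckeConjEquivariant c ψ ∧ ¬ ψ.IsUnramifiedAt v ∧ ¬ ψ.IsUnramifiedAt vbar ∧ c • v = vbar ∧
      S.image (fun w ↦ c • w) = S ∧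
      (∀ φ : HeckeCharacter K, φ.HasInfinityType (fun _ ↦ 1) (fun _ ↦ 0) →
        (∀ s : ℂ, 3 / 2 < s.re → heckeLFunction φ s = W.LSeries s) → φ = ψ) ∧
      ¬ (2 : ℤ) ∣ NumberField.discr K := by
  have heq : IsHeckeConjEquivariant c ψ :=
    DeuringShape.isHeckeConjEquivariant_of_pinned hK c hc hψ W (3 / 2) hL
  have hram := not_isUnramifiedAt_two_of_frame hK hsq hd4 W hC hv hvbar hne hL
  exact ⟨heq, hram.1, hram.2, smul_eq_of_frame hK.1 c hc hv hvbar hne,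
    image_smul_frameSet_eq hK.1 c hc heq hv hvbar hne hS,
    fun φ hφ hφL ↦ eq_of_pinned hK hφ hψ W (3 / 2) hφL hL,
    not_two_dvd_discr_of_ne hK.1 hv hvbar hne⟩

end Summit.BirchSwinnertonDyer.BirchSwinnertonDyer.Theorems.PrintCf2.FramePinning

end
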